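/-
Copyright (c) 2026 the pub-hodgecm-mathlib formalisation cell (harness21).  Prover seat hodgecm-mathlib-F0P3a-p06 (g18), 2026-09-02: the JUNCTION of the wild base layer
(★ `RamifiedPlaceDifferent` … `RamifiedPlaceTraceDual`) with Mathlib's `differentIdeal` through the abc-iut cell's ★ `DifferentCompletionExponent` (Serre III §4 Prop. 10).
-/
import Literature.NumberTheory.Automorphic.RamifiedPlaceTraceDual          -- ★ p851014: `forall_valued_add_galAdicCompletionMap_mul_le_one_iff` (`𝔇_w⁻¹ = 𝔭_w^{−d}`), brings ★ p850872
import Literature.NumberTheory.NumberFields.DifferentCompletionExponent     -- ★ abc-iut: `pow_dvd_differentIdeal_iff_local` (Serre III §4 Prop. 10, exponent form)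
import Literature.NumberTheory.LocalFields.QuadraticLocalTracePlace        -- ★ p851136 (LH4-p02 (g5)): the TRACE BRIDGE `IsCMField.algebraMap_trace_place_eq_add` (`Tr x = x + σ_w x`), over ★ (J2)
import HarnessLib

/-!
# The different number is the exponent of `𝔓_w` in Mathlib's `differentIdeal (𝓞 L⁺) (𝓞 L)`: `𝔓_w^n ∣ 𝔇 ⟺ |σ_w τ − τ|_w ≤ exp(−n)`
# (Serre III §4 Prop. 10, III §6, IV §1 Prop. 4; Cassels–Fröhlich VII §1.1) — EDITION 2 of the report-first: the trace bridge is ★ LH4-p02 (g5)'s `QuadraticLocalTracePlace` (one-writer cut, LH4-plan (g5) WORD #25)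

Topic `NumberTheory/Automorphic`; namespace `Literature.NumberTheory.Automorphic.UnitaryGroup`.  THEOREMS ONLY (no definition, no instance, no notation, no named fact, no `sorry`; axioms ⊆ {propext,
Classical.choice, Quot.sound}).  Cell `pub/hodgecm-mathlib` (D-0151), crux H413 = `stmt-HodgeConjecture-24833`; half A line LH4, DYADIC pay-down leaf
`Cruxes/H413/Lines/F0_P3c_DyadicPaydown.lean`, organ (D-RAM) (PRINT by ruling D74′, scope audit b4c7662647f1db69 «COVERED at v ∣ 2»): BANKED base layer — this file is
the JUNCTION that makes the layer's different number `d` (★ p850872, p850893, p850961, p850931, p851014, p851024, p851058, p851071, p851075) literally the multiplicity of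
`𝔓_w` in Mathlib's global `differentIdeal (𝓞 L⁺) (𝓞 L)`.  HONEST LABEL: HC_CM is proved only modulo the 7 printed citations (2 remaining named inputs: hLiu418 =
stmt-HodgeConjecture-24832, h413 = stmt-HodgeConjecture-24833) until rung 0 closes; unconditional, count-neutral.

THREE CURRENCIES, ONE OBJECT (checked `rfl` on the farm before typing): for `w : UnitaryGroup.PlacesOver L v` the place `⟨w.1, w.2⟩` is at once a ★ `SemiLocal.Place L⁺ L v`
((J2)'s currency, instance ★ `SemiLocal.algebraPlace`) and a `v.Extension (𝓞 L)` (the adelic base-change packet's currency, instance `(adicCompletionSemialgHom).toAlgebra`,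
used by ★ `DifferentCompletionExponent`); both instances and the unitary files' `toPlace v w` are DEFINITIONALLY the tree's `adicCompletionOfLiesOver` (★
`AutomorphicCompat.adicCompletionSemialgHom_apply_eq_adicCompletionOfLiesOver`), so no transport lemma beyond `rfl` is needed.
* §1 (★ LH4-p02 (g5) p851136 `QuadraticLocalTracePlace`, imported): the TRACE BRIDGE `IsCMField.algebraMap_trace_place_eq_add : algebraMap (Algebra.trace L⁺_v x) = x + σ_w x`;
  here only its unitary∕packet dress `toPlace_trace_eq_add` (`toPlace v w (Tr x) = x + σ_w x` for the packet's instance at `(⟨w.1, w.2⟩ : v.Extension (𝓞 L))`, by `exact` — defeq).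
* §2 `forall_mul_mem_iff_valued_le_exp` — «`z·𝔓^n ⊆ 𝒪_w` iff `|z|_w ≤ exp n`» (a uniformiser of `𝓞 L` at `w`, Mathlib `intValuation_exists_uniformizer` ∕ `intValuation_le_pow_iff_mem`);
  `trace_mul_mem_iff_valued_add_le_one` — «`Tr(z y) ∈ 𝒪_v` iff `|z y + σ(z y)|_w ≤ 1`» (§1 + `|ι t|_w = |t|_v²`).
* §3 **JUNCTION `pow_dvd_differentIdeal_iff_valued_le (he) (hτ) (n) : w.1.asIdeal ^ n ∣ differentIdeal (𝓞 L⁺) (𝓞 L) ↔ Valued.v (σ τ − τ) ≤ exp (−n)`** (★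
  `pow_dvd_differentIdeal_iff_local` ∘ §2 ∘ ★ p851014 §3); corollaries `pow_dvd_differentIdeal_and_not_pow_succ_dvd (hd)` (EXACT exponent `d`), `dvd_differentIdeal_of_ramified`
  (`𝔓_w ∣ 𝔇` — ramified primes divide the different), **`sq_dvd_differentIdeal_iff_valued_two_lt_one : 𝔓_w² ∣ 𝔇 ↔ |2|_w < 1`** (Dedekind: WILD iff `𝔓² ∣ 𝔇`, at a ramified CM
  place; consistent with ★ `NumberFields/DifferentTameRamification`, cited not imported).

## References
* [Serre1979] J.-P. Serre, *Local Fields*, GTM 67 (1979): Ch. III §4 Prop. 10 (different and completion), §6 Prop. 13 (Dedekind: `e − 1 ≤ v_𝔓(𝔇)`, equality iff tame), Ch. IV §1 Prop. 4.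
* [CasselsFrohlichANT1967] J. W. S. Cassels, A. Fröhlich (eds.), *Algebraic Number Theory* (1967): Ch. VII (Tate) §1.1 (`G_w = Gal(E_w∕F_v)`), Ch. II §10.
* [NeukirchANT1999] J. Neukirch, *Algebraic Number Theory* (1999): Ch. III §2 (2.6) (Dedekind's different theorem), Ch. II (9.6).
-/

set_option autoImplicit false

noncomputable section

open scoped NumberField WithZero

/-! ## §1 (★ `QuadraticLocalTracePlace`) and §2: the unitary ∕ packet dress and the two local dictionaries -/

namespace Literature.NumberTheory.Automorphic.UnitaryGroup

open _root_.NumberField _root_.IsDedekindDomain _root_.ValuativeRel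
open scoped ValuativeRel

variable (L : Type) [Field L] [NumberField L] [IsCMField L] (v : HeightOneSpectrum (𝓞 ↥(maximalRealSubfield L)))
  (w : PlacesOver L v) (hw : IsCMField.complexConj L • w.1 = w.1) (he : v.asIdeal.ramificationIdx' w.1.asIdeal ≠ 1)

/-- **`toPlace v w (Tr x) = x + σ_w x`** in the unitary files' letters, the trace taken for the adelic base-change packet's `Algebra (L⁺_v) (L_w)` instance at
`(⟨w.1, w.2⟩ : v.Extension (𝓞 L))` (the instance under which ★ `DifferentCompletionExponent` speaks) — definitionally the same as ★ `SemiLocal.algebraPlace` and as `toPlace v w`.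
[cite: CasselsFrohlichANT1967, Ch. VII §1.1, Ch. II §10] -/
theorem toPlace_trace_eq_add (x : w.1.adicCompletion L) :
    toPlace v w (Algebra.trace (v.adicCompletion ↥(maximalRealSubfield L)) ((⟨w.1, w.2⟩ : v.Extension (𝓞 L)).1.adicCompletion L) x) =
      x + galAdicCompletionMap (L := L) (IsCMField.complexConj L) hw x :=
  Literature.NumberTheory.LocalFields.IsCMField.algebraMap_trace_place_eq_add L
    (⟨w.1, w.2⟩ : Literature.NumberTheory.GaloisRepresentations.SemiLocal.Place ↥(maximalRealSubfield L) L v) hw x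

omit [IsCMField L] in
/-- **«`z · 𝔓_w^n ⊆ 𝒪_w` iff `|z|_w ≤ exp n`»**: the packet-side hypothesis of ★ `pow_dvd_differentIdeal_iff_local` read in valuations (a uniformiser `π ∈ 𝓞 L` at `w` realises
`|π^n|_w = exp(−n)`; Mathlib `intValuation_exists_uniformizer`, `intValuation_le_pow_iff_mem`). [cite: Serre1979, Ch. III §4 Prop. 10] -/
theorem forall_mul_mem_iff_valued_le_exp (n : ℕ) (z : w.1.adicCompletion L) :
    (∀ b ∈ w.1.asIdeal ^ n, algebraMap (𝓞 L) (w.1.adicCompletion L) b * z ∈ w.1.adicCompletionIntegers L) ↔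
      Valued.v z ≤ WithZero.exp (n : ℤ) := by
  have hval : ∀ b : 𝓞 L, Valued.v (algebraMap (𝓞 L) (w.1.adicCompletion L) b) = w.1.intValuation b := fun b => by
    rw [IsScalarTower.algebraMap_apply (𝓞 L) L (w.1.adicCompletion L)]
    show Valued.v ((algebraMap (𝓞 L) L b : L) : w.1.adicCompletion L) = _
    rw [HeightOneSpectrum.valuedAdicCompletion_eq_valuation', HeightOneSpectrum.valuation_of_algebraMap]
  constructor
  · intro h
    obtain ⟨π, hπ⟩ := w.1.intValuation_exists_uniformizer
    have hπn : π ^ n ∈ w.1.asIdeal ^ n := by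
      rw [← HeightOneSpectrum.intValuation_le_pow_iff_mem, map_pow, hπ, ← WithZero.exp_nsmul]; simp
    have h1 := h _ hπn
    rw [HeightOneSpectrum.mem_adicCompletionIntegers, map_mul, hval, map_pow, hπ, ← WithZero.exp_nsmul] at h1
    simp only [nsmul_eq_mul, mul_neg, mul_one] at h1
    -- `exp(-n) * |z| ≤ 1`
    calc Valued.v z = WithZero.exp (n : ℤ) * (WithZero.exp (-(n : ℤ)) * Valued.v z) := by
          rw [← mul_assoc, ← WithZero.exp_add]; simp
      _ ≤ WithZero.exp (n : ℤ) * 1 := by gcongr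
      _ = WithZero.exp (n : ℤ) := mul_one _
  · intro hz b hb
    rw [HeightOneSpectrum.mem_adicCompletionIntegers, map_mul, hval]
    have hb' : w.1.intValuation b ≤ WithZero.exp (-(n : ℤ)) := (HeightOneSpectrum.intValuation_le_pow_iff_mem _ _ _).2 hb
    calc w.1.intValuation b * Valued.v z ≤ WithZero.exp (-(n : ℤ)) * WithZero.exp (n : ℤ) := by gcongr
      _ = 1 := by rw [← WithZero.exp_add]; simp

include he in
/-- **«`Tr(t) ∈ 𝒪_v` iff `|t + σ t|_w ≤ 1`»** for `t ∈ L_w` (trace bridge + `|ι s|_w = |s|_v²` at a ramified place). [cite: Serre1979, Ch. III §4 Prop. 10] [cite: CasselsFrohlichANT1967, Ch. VII §1.1] -/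
theorem trace_mem_iff_valued_add_le_one (t : w.1.adicCompletion L) :
    Algebra.trace (v.adicCompletion ↥(maximalRealSubfield L)) ((⟨w.1, w.2⟩ : v.Extension (𝓞 L)).1.adicCompletion L) t ∈
        v.adicCompletionIntegers ↥(maximalRealSubfield L) ↔
      Valued.v (t + galAdicCompletionMap (L := L) (IsCMField.complexConj L) hw t) ≤ 1 := by
  rw [HeightOneSpectrum.mem_adicCompletionIntegers, ← toPlace_trace_eq_add L v w hw t, valued_toPlace_eq_sq_of_ramified L v w hw he, sq_le_one_iff_withZero]

/-! ## §3 The junction with `differentIdeal (𝓞 L⁺) (𝓞 L)` -/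

include he in
/-- **THE DIFFERENT NUMBER IS THE EXPONENT OF `𝔓_w` IN `differentIdeal (𝓞 L⁺) (𝓞 L)`.**  At a ramified place `w ∣ v` of the CM extension `L ∕ L⁺` (any residue characteristic) and
for any uniformiser `τ` of `L_w`: `𝔓_w^n ∣ 𝔇_{𝓞L∕𝓞L⁺} ↔ |σ_w τ − τ|_w ≤ exp(−n)` — Serre's «the different is preserved by completion» (★ `pow_dvd_differentIdeal_iff_local`) composed with
the local inverse different `𝔇_w⁻¹ = 𝔭_w^{−d}` (★ `forall_valued_add_galAdicCompletionMap_mul_le_one_iff`). [cite: Serre1979, Ch. III §4 Prop. 10, Ch. III §6, Ch. IV §1 Prop. 4] -/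
theorem pow_dvd_differentIdeal_iff_valued_le {τ : w.1.adicCompletion L} (hτ : Valued.v τ = WithZero.exp (-1 : ℤ)) (n : ℕ) :
    w.1.asIdeal ^ n ∣ differentIdeal (𝓞 ↥(maximalRealSubfield L)) (𝓞 L) ↔
      Valued.v (galAdicCompletionMap (L := L) (IsCMField.complexConj L) hw τ - τ) ≤ WithZero.exp (-(n : ℤ)) := by
  set D := Valued.v (galAdicCompletionMap (L := L) (IsCMField.complexConj L) hw τ - τ) with hDdef
  rw [Literature.NumberTheory.NumberFields.pow_dvd_differentIdeal_iff_local ↥(maximalRealSubfield L) L v (⟨w.1, w.2⟩ : v.Extension (𝓞 L)) n]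
  -- rewrite the packet-side condition in valuations
  have key : (∀ z : w.1.adicCompletion L,
      (∀ b ∈ w.1.asIdeal ^ n, algebraMap (𝓞 L) (w.1.adicCompletion L) b * z ∈ w.1.adicCompletionIntegers L) →
        ∀ y ∈ w.1.adicCompletionIntegers L,
          Algebra.trace (v.adicCompletion ↥(maximalRealSubfield L)) ((⟨w.1, w.2⟩ : v.Extension (𝓞 L)).1.adicCompletion L) (z * y) ∈
            v.adicCompletionIntegers ↥(maximalRealSubfield L)) ↔
      ∀ z : w.1.adicCompletion L, Valued.v z ≤ WithZero.exp (n : ℤ) → Valued.v z * D ≤ 1 := by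
    refine forall_congr' fun z => ?_
    rw [forall_mul_mem_iff_valued_le_exp L v w n z]
    refine imp_congr_right fun _ => ?_
    rw [← forall_valued_add_galAdicCompletionMap_mul_le_one_iff L v w hw he hτ z]
    refine ⟨fun h x hx => ?_, fun h y hy => ?_⟩
    · have := h x ((HeightOneSpectrum.mem_adicCompletionIntegers _ _ _).2 hx)
      rw [trace_mem_iff_valued_add_le_one L v w hw he, mul_comm z x] at this
      exact this
    · rw [trace_mem_iff_valued_add_le_one L v w hw he, mul_comm z y]
      exact h y ((HeightOneSpectrum.mem_adicCompletionIntegers _ _ _).1 hy)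
  -- this `change` only replaces `(⟨w.1, w.2⟩ : v.Extension (𝓞 L)).1` by `w.1` (definitional)
  refine key.trans ?_
  have hD0 : D ≠ 0 := valued_galAdicCompletionMap_sub_self_ne_zero L v w hw he hτ
  have hτ0 : τ ≠ 0 := fun h => by rw [h, map_zero] at hτ; exact WithZero.zero_ne_coe hτ
  constructor
  · intro h
    -- take `z = τ⁻ⁿ`, `|z| = exp n`
    have hz : Valued.v (τ⁻¹ ^ n) = WithZero.exp (n : ℤ) := by
      rw [map_pow, map_inv₀, hτ, ← WithZero.exp_neg, ← WithZero.exp_nsmul]; simp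
    have h1 := h (τ⁻¹ ^ n) hz.le
    rw [hz] at h1
    calc D = WithZero.exp (-(n : ℤ)) * (WithZero.exp (n : ℤ) * D) := by rw [← mul_assoc, ← WithZero.exp_add]; simp
      _ ≤ WithZero.exp (-(n : ℤ)) * 1 := by gcongr
      _ = WithZero.exp (-(n : ℤ)) := mul_one _
  · intro hD z hz
    calc Valued.v z * D ≤ WithZero.exp (n : ℤ) * WithZero.exp (-(n : ℤ)) := by gcongr
      _ = 1 := by rw [← WithZero.exp_add]; simp

include he in
/-- **EXACT EXPONENT**: if `|σ_w τ − τ|_w = exp(−d)` for (every) uniformiser `τ`, then `𝔓_w^d ∣ 𝔇_{𝓞L∕𝓞L⁺}` and `𝔓_w^{d+1} ∤ 𝔇` — the different NUMBER of ★ `RamifiedPlaceDifferent` is the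
multiplicity of `𝔓_w` in Mathlib's different ideal. [cite: Serre1979, Ch. III §4 Prop. 10, Ch. IV §1 Prop. 4] -/
theorem pow_dvd_differentIdeal_and_not_pow_succ_dvd {d : ℕ}
    (hd : ∀ τ : w.1.adicCompletion L, Valued.v τ = WithZero.exp (-1 : ℤ) →
      Valued.v (galAdicCompletionMap (L := L) (IsCMField.complexConj L) hw τ - τ) = WithZero.exp (-(d : ℤ))) :
    w.1.asIdeal ^ d ∣ differentIdeal (𝓞 ↥(maximalRealSubfield L)) (𝓞 L) ∧
      ¬ w.1.asIdeal ^ (d + 1) ∣ differentIdeal (𝓞 ↥(maximalRealSubfield L)) (𝓞 L) := by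
  obtain ⟨π, hπ⟩ := w.1.valuation_exists_uniformizer L
  have hτ : Valued.v (π : w.1.adicCompletion L) = WithZero.exp (-1 : ℤ) := by rw [HeightOneSpectrum.valuedAdicCompletion_eq_valuation', hπ]
  rw [pow_dvd_differentIdeal_iff_valued_le L v w hw he hτ, pow_dvd_differentIdeal_iff_valued_le L v w hw he hτ, hd _ hτ, WithZero.exp_le_exp, WithZero.exp_le_exp]
  push_cast
  omega

include hw he in
/-- **RAMIFIED PRIMES DIVIDE THE DIFFERENT**: `𝔓_w ∣ 𝔇_{𝓞L∕𝓞L⁺}` at a ramified CM place (`d ≥ 1`). [cite: Serre1979, Ch. III §6 Prop. 13] [cite: NeukirchANT1999, Ch. III §2 (2.6)] -/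
theorem dvd_differentIdeal_of_ramified : w.1.asIdeal ∣ differentIdeal (𝓞 ↥(maximalRealSubfield L)) (𝓞 L) := by
  obtain ⟨d, hd1, hd, -⟩ := exists_different_of_ramified L v w hw he
  obtain ⟨hdvd, -⟩ := pow_dvd_differentIdeal_and_not_pow_succ_dvd L v w hw he hd
  exact (dvd_pow_self _ (by omega)).trans hdvd

include hw he in
/-- **DEDEKIND AT A RAMIFIED CM PLACE: WILD ⟺ `𝔓_w² ∣ 𝔇`.**  `𝔓_w^2 ∣ 𝔇_{𝓞L∕𝓞L⁺} ↔ |2|_w < 1` (`d ≥ 2` iff not tame, ★ `valued_galAdicCompletionMap_sub_self_eq_exp_neg_one_iff`).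
[cite: Serre1979, Ch. III §6 Prop. 13] [cite: NeukirchANT1999, Ch. III §2 (2.6)] -/
theorem sq_dvd_differentIdeal_iff_valued_two_lt_one :
    w.1.asIdeal ^ 2 ∣ differentIdeal (𝓞 ↥(maximalRealSubfield L)) (𝓞 L) ↔ Valued.v (2 : w.1.adicCompletion L) < 1 := by
  obtain ⟨π, hπ⟩ := w.1.valuation_exists_uniformizer L
  have hτ : Valued.v (π : w.1.adicCompletion L) = WithZero.exp (-1 : ℤ) := by rw [HeightOneSpectrum.valuedAdicCompletion_eq_valuation', hπ]
  have htame := valued_galAdicCompletionMap_sub_self_eq_exp_neg_one_iff L v w hw he hτ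
  have hle1 := valued_galAdicCompletionMap_sub_self_le_exp_neg_one L v w hw hτ
  have hD0 := valued_galAdicCompletionMap_sub_self_ne_zero L v w hw he hτ
  -- `|2|_w ≤ 1` always
  have h2le : Valued.v (2 : w.1.adicCompletion L) ≤ 1 := by
    rw [show (2 : w.1.adicCompletion L) = 1 + 1 by norm_num]
    exact (Valuation.map_add _ _ _).trans (by rw [Valuation.map_one, max_self])
  rw [pow_dvd_differentIdeal_iff_valued_le L v w hw he hτ]
  obtain ⟨m, hm⟩ : ∃ m : ℤ, Valued.v (galAdicCompletionMap (L := L) (IsCMField.complexConj L) hw π - π) = WithZero.exp m :=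
    ⟨_, (WithZero.exp_log hD0).symm⟩
  rw [hm] at htame hle1 ⊢
  rw [WithZero.exp_le_exp] at hle1
  rw [WithZero.exp_inj] at htame
  rw [WithZero.exp_le_exp, lt_iff_le_and_ne, and_iff_right h2le, Ne, ← htame]
  push_cast
  omega

end Literature.NumberTheory.Automorphic.UnitaryGroup

end
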